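import Summits.ABC.IUTFork.Cor312NotLicencePrVolSharp
import Summits.ABC.IUTFork.Cor312VolumesPadicLatticeBounds
import HarnessLib

/-!
# [IUTchIII] Cor. 3.12, Step (xi-f) `Licence` at the print-normalised assembled real setting with SHARP pilot
# regions — FAILS at a CONSTANT bad tuple for every datum whose `q`-order there is large (threshold free of the ideles)

PROOF-ONLY record file (D-0012; no definitions, no `Prop` facts) of the abc-iut cell (WAVE-5 discharge seat
abc-iut-w5-d107, gen 6; second hand on the C-R12 (b) TEST of abc-iut-plan / abc-iut-C-cert-2, director-abc EVENT
DIRECTIVE (E3)); sequel of this seat's `Cor312NotLicencePrVolSharp` (the lattice criterion). TAKES NO SIDE on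
[IUTchIII] Cor. 3.12.

CONTENTS, for abc-iut-c312-7's `Real.settingPrVolSharp` (real log-shells of `F`, Dupuy–Hilado §3.9 SHARP Θ-boxes
`ι_j(t_{Θ,j,v_j})·(R_I)^∼` and `q`-centre read off ideles `t`, `tq`), a prime `p` and a label `j = i+1 ∈ 𝔽_l^⋇`:
* §1 (any `p`-adic presentation, abc-iut-c312-5's `PadicPresentation`): `exists_const_mem_smul_logShell_of_norm_le_one`
  — ONE scalar `c ≠ 0` with `(R_I)^∼_{v⃗} ⊆ c·I_{v⃗}` at EVERY summand `v⃗` (absorption, abc-iut-c312-5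
  `exists_latticeF_of_norm_le`, summand by summand through `Pi.single`); `exists_norm_le_of_mem_smul_logShell` — ONE
  radius bounding every factor coordinate of every `c·I_{v⃗}` (abc-iut-c312-5 `exists_norm_le_of_mem_latticeF`);
* §2 `sharpBoxDH_subset_normalizedPacket` (`‖t‖ ≤ 1`), `sharpBoxDH_subset_smul_of_norm_le` (at a summand whose last
  place `x₀` has `‖t_{Θ,j,x₀}‖ ≤ ‖p^m‖`: the sharp box lies in `p^m·(R_I)^∼`, abc-iut-w4-d036
  `iota_smul_normalizedPacket_subset_of_norm_le_slot`);
* §3 **`not_licence_settingPrVolSharp_of_constTuple`**: with `c` absorbing and `a` bounding as in §1, Θ-ideles of norm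
  `≤ 1`, and at ONE place `x₀ | p`: `‖t_{Θ,j,x₀}‖ ≤ ‖p^m‖` and `‖p^m‖·‖a‖ < ‖t_{q,x₀}‖` ⊢ `¬ Licence` — the criterion of the
  parent file at the CONSTANT tuple `v⃗₀ = (x₀, …, x₀)` with the capsule-symmetric scalar function
  `c(v⃗) = p^m·c` on `v⃗₀`, `c` elsewhere (capsule permutations FIX `v⃗₀`: no slot-symmetrisation residue);
* §4 **`exists_threshold_not_licence_settingPrVolSharp`**: `∃ C > 0` depending only on the setting data OTHER than
  the ideles (the factor-coordinate radius of the absorbing log-shell lattice at `(j, p)`) such that for ALL ideles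
  `t` (norms `≤ 1`), `tq` (nonzero, units off `S`) and every `x₀ | p`, `m ∈ ℤ` with `‖t_{Θ,j,x₀}‖ ≤ ‖p^m‖` and
  `‖p^m‖·C < ‖t_{q,x₀}‖`: `¬ Licence (settingPrVolSharp … tq t …)`. For REALISING ideles (`‖t_{Θ,j,v}‖ = ‖t_{q,v}‖^{j²}`,
  abc-iut-w4-d036 `log_norm_thetaIdele_eq_of_realises`) the two conditions read `‖t_{q,x₀}‖^{j²−1} < (C·p)⁻¹`, i.e.
  «`(j²−1)·ord_{x₀}(t_q)` exceeds a constant of the field data at `x₀`»: the LARGE-ORDER REGIME (e.g. the `λ`-line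
  points of the route `IUTThetaPilot`, whose `ord_v(q_v)` is unbounded). In that regime the hull-level residual
  S_H = `Cor312Vol.PilotKummerCompatHull` under the q-pin (= `Licence`, abc-iut-w5-d068
  `licence_of_pilotKummerCompatHull`) is REFUTED at the sharp honestly-scaled genuine setting, in our typing.

READING (neutral, numbers not adjectives). The threshold `C` is NOT made explicit here ([IUTchIV] Prop. 1.2 bounds it by
the ramification data `d, a, b` of the `F_v`, `v | p` — an upgrade, not needed for the regime statement). Below the
threshold nothing is claimed: there the (Ind2) log-shell inflation may well cover the q-box at small labels (the
slot-symmetrised hull computation of the S-lane decides). This is a statement about OUR typed objects in the SHARP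
reading (Θ-possible-image set constant in `m`; (Ind2) = Dupuy–Hilado's factorwise lattice automorphisms); it does not
bear on the NUMBER-level Corollary (`Cor22.Cor312AtDatum`) nor on any author's intended reading.
[claim: Mochizuki2012, status: disputed] for [IUTchIII] Cor. 3.12 Step (xi-f); [cite: DupuyHilado2025, §3.9, §4 (intro),
§4.7, §4.9, §4.10]; [cite: ScholzeStix2018, §2.2 pp. 9–10]. HONEST FRAMING: nothing here asserts that abc or
[IUTchIII] Cor. 3.12 is proved or refuted; typed ≠ proved; instantiated ≠ endorsed.
-/

noncomputable section

open Set Function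
open scoped Pointwise

namespace Summit.ABC

namespace IUTFork

/-! ## §1. One absorbing scalar and one bounding radius for all summands of a prime packet -/

namespace Cor312Vol

namespace PadicPresentation

open Thm311 Literature.IUT.LogThetaLattice Literature.IUT.LogVolume

variable {T : ThetaIndex} {L : LogShells T} {vQ : T.VQ} {p : ℕ} [hp : Fact p.Prime] (P : PadicPresentation L vQ p)
  {j : T.Label}

/-- Field-factor coordinates of a family supported on ONE summand, at that summand: `ψ_{v⃗}(y)`. [folklore] -/
theorem factorCoords_single_self [DecidableEq (T.Caps j → T.Fibre vQ)] (e : T.Caps j → T.Fibre vQ) (y : P.X e)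
    (i : DIdx p (P.kk e)) :
    P.factorCoords j (Pi.single (M := fun e => P.X e) e y) ⟨e, i⟩ = dEquiv p (P.kk e) y i := by
  simp [factorCoords]

/-- … and `0` at every other summand. [folklore] -/
theorem factorCoords_single_of_ne [DecidableEq (T.Caps j → T.Fibre vQ)] (e : T.Caps j → T.Fibre vQ) (y : P.X e)
    {e' : T.Caps j → T.Fibre vQ} (h : e' ≠ e) (i : DIdx p (P.kk e')) :
    P.factorCoords j (Pi.single (M := fun e => P.X e) e y) ⟨e', i⟩ = 0 := by
  simp [factorCoords, Pi.single_eq_of_ne h]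

/-- **ABSORPTION, summand by summand**: ONE scalar `c ≠ 0` such that at EVERY summand `v⃗` of the `(j+1)`-packet over
`p` every element of `X_{v⃗}` with all field-factor coordinates of norm `≤ 1` — i.e. of `(R_I)^∼_{v⃗}` — lies in the
scaled log-shell `c·I_{v⃗}` (abc-iut-c312-5 `exists_latticeF_of_norm_le` with `R = 1`, read on families supported
on one summand). [cite: DupuyHilado2025, §4.10] -/
theorem exists_const_mem_smul_logShell_of_norm_le_one (j : T.Label) :
    ∃ c : ℚ_[p], c ≠ 0 ∧ ∀ (e : T.Caps j → T.Fibre vQ) (y : P.X e),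
      (∀ i, ‖dEquiv p (P.kk e) y i‖ ≤ 1) → y ∈ c • logShell p (P.kk e) := by
  classical
  obtain ⟨c, hc, h⟩ := P.exists_latticeF_of_norm_le (j := j) 1
  refine ⟨c, hc, fun e y hy => ?_⟩
  have hz1 : ∀ s, ‖P.factorCoords j (Pi.single (M := fun e => P.X e) e y) s‖ ≤ 1 := by
    rintro ⟨e', i⟩
    by_cases h' : e' = e
    · subst h'
      rw [factorCoords_single_self]
      exact hy i
    · rw [P.factorCoords_single_of_ne e y h', norm_zero]
      exact zero_le_one
  obtain ⟨w, hw, hwz⟩ := (P.mem_latticeF_iff c _).1 (h _ hz1) e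
  have hwy : w = y := by
    apply (dEquiv p (P.kk e)).injective
    funext i
    rw [congrFun hwz i, factorCoords_single_self]
  exact hwy ▸ hw

/-- **ONE bounding radius**: for every scalar `c`, a real `R ≥ 0` bounding every field-factor coordinate of every
element of every `c·I_{v⃗}` over the `(j+1)`-packet at `p` (abc-iut-c312-5 `exists_norm_le_of_mem_latticeF`, read on
families supported on one summand). [cite: DupuyHilado2025, §4 (intro)] -/
theorem exists_norm_le_of_mem_smul_logShell (j : T.Label) (c : ℚ_[p]) :
    ∃ R : ℝ, 0 ≤ R ∧ ∀ (e : T.Caps j → T.Fibre vQ), ∀ y ∈ c • logShell p (P.kk e),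
      ∀ i, ‖dEquiv p (P.kk e) y i‖ ≤ R := by
  classical
  obtain ⟨R, hR0, hR⟩ := P.exists_norm_le_of_mem_latticeF (j := j) c
  refine ⟨R, hR0, fun e y hy i => ?_⟩
  have hzmem : P.factorCoords j (Pi.single (M := fun e => P.X e) e y) ∈ P.latticeF j c := by
    rw [P.mem_latticeF_iff]
    intro e'
    by_cases h' : e' = e
    · subst h'
      refine ⟨y, hy, funext fun i => ?_⟩
      rw [factorCoords_single_self]
    · have h0 : (fun i => P.factorCoords j (Pi.single (M := fun e => P.X e) e y) ⟨e', i⟩) = 0 := by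
        funext i
        rw [P.factorCoords_single_of_ne e y h']
        rfl
      rw [h0]
      exact P.zero_mem_image_smul_logShell e' c
  have h := hR _ hzmem ⟨e, i⟩
  rw [factorCoords_single_self] at h
  exact h

end PadicPresentation

end Cor312Vol

/-! ## §2–§4. At `Real.settingPrVolSharp` -/

namespace Thm311

namespace Real

open Cor312 Cor312Vol Literature.IUT.LogThetaLattice Literature.IUT.LogVolume

variable {F : Type} [Field F] [NumberField F] (X : PilotData F) {logv : PadicLogs F} (hlog : LogvAnalytic logv)
  (M : Type) [Field M] [NumberField M]
  (archPk : ∀ (j : (thetaIndex X).Label) (vQ : (thetaIndex X).VQ), Set ((logShellsDH X logv).Packet j vQ))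
  (archSub : ∀ (j : (thetaIndex X).Label) (v : (thetaIndex X).V),
    Set ((logShellsDH X logv).Packet j ((thetaIndex X).over v)))
  (Ψ : ℤ → ∀ v : (thetaIndex X).V, v ∈ (thetaIndex X).Vbad → Set ((logShellsDH X logv).StarPacket v))
  (act : ℤ → ∀ v : (thetaIndex X).V, v ∈ (thetaIndex X).Vbad →
    (logShellsDH X logv).StarPacket v → Module.End ℚ ((logShellsDH X logv).StarPacket v))
  (Mmod : ℤ → ∀ j : (thetaIndex X).LabelStar, Set ((logShellsDH X logv).GlobalPacket j.1))
  (region : ℤ → ∀ j : (thetaIndex X).LabelStar, FinDivisor M → ∀ vQ : (thetaIndex X).VQ,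
    Set ((logShellsDH X logv).Packet j.1 vQ))
  (n : ℤ) {HT : Type} {LogLink : HT → HT → Type} {IsFull : ∀ {s t : HT}, LogLink s t → Prop}
  (lat : LGPGaussianLogThetaLattice LogLink IsFull)
  {Frd : Type} {IsoF : Frd → Frd → Type} {Ob : Frd → Type} {realify : Frd → Frd} {Strip : Type}
  {IsoS : Strip → Strip → Type} {Mv : ∀ v : (thetaIndex X).V, v ∈ (thetaIndex X).Vbad → Type}
  [∀ v h, Monoid (Mv v h)]
  (sig : GlobalLGPFrobenioidSignature (thetaIndex X).lstar (thetaIndex X).V (· ∈ (thetaIndex X).Vbad)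
    Frd IsoF Ob realify Strip IsoS Mv)
  (split : SplittingMonoids Mv) {ObΔ : Type} {N : ∀ v : (thetaIndex X).V, v ∈ (thetaIndex X).Vbad → Type}
  [∀ v h, Monoid (N v h)] (qData : QPilotData ObΔ N)

/-! ### §2. The sharp boxes: inside `(R_I)^∼`, and inside `p^m·(R_I)^∼` where `‖t_Θ‖ ≤ ‖p^m‖` -/

section Sharp

variable (t : ∀ (pp : Nat.Primes) (_ : Fin X.lstar) (x : (thetaIndex X).Fibre (.inr pp)),
    haveI : Fact (pp : ℕ).Prime := ⟨pp.2⟩; kOf X pp.1 x)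

/-- The label idele has norm `≤ 1` when the Θ-ideles do (at the label `0` it is `1`). [cite: DupuyHilado2025, §3.9] -/
theorem norm_labelIdele_le_one (ht : ∀ pp i x, ‖t pp i x‖ ≤ 1) (pp : Nat.Primes) (j : (thetaIndex X).Label)
    (x : (thetaIndex X).Fibre (.inr pp)) : ‖labelIdele X t pp j x‖ ≤ 1 := by
  unfold labelIdele
  split_ifs
  · exact ht _ _ _
  · exact norm_one.le

/-- **Sharp boxes lie in `(R_I)^∼`** for Θ-ideles of norm `≤ 1`: `ι_j(a)·(R_I)^∼ ⊆ (R_I)^∼` since `ι_j(a) ∈ R_I ⊆ (R_I)^∼`,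
a subring (abc-iut-S8 `iota_mem_integerPacket`, abc-iut-S1 `integerPacket_le_normalizedPacket`).
[cite: Mochizuki2012, IUTchIV Prop. 1.4 (i) p. 13] -/
theorem sharpBoxDH_subset_normalizedPacket (ht : ∀ pp i x, ‖t pp i x‖ ≤ 1) (pp : Nat.Primes)
    (j : (thetaIndex X).Label) (e : (thetaIndex X).Caps j → (thetaIndex X).Fibre (.inr pp)) :
    haveI : Fact (pp : ℕ).Prime := ⟨pp.2⟩
    sharpBoxDH X hlog t pp j e ⊆ (normalizedPacket pp.1 ((presAtPr X hlog pp).kk e) : Set ((presAtPr X hlog pp).X e)) := by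
  haveI : Fact (pp : ℕ).Prime := ⟨pp.2⟩
  haveI : Nonempty ((thetaIndex X).Caps j) := ⟨0⟩
  rintro _ ⟨y, hy, rfl⟩
  exact mul_mem (integerPacket_le_normalizedPacket pp.1 _
    (iota_mem_integerPacket pp.1 _ (Fin.last _) (norm_labelIdele_le_one X t ht pp j _))) hy

/-- **At a summand whose last place `x₀` has `‖t_{Θ,j,x₀}‖ ≤ ‖p^m‖` the sharp box lies in `p^m·(R_I)^∼`**
(`ι_j(t)·(R_I)^∼ ⊆ ι_j(p^m)·(R_I)^∼ = p^m·(R_I)^∼`, abc-iut-w4-d036 `iota_smul_normalizedPacket_subset_of_norm_le_slot`).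
[cite: Mochizuki2012, IUTchIV Prop. 1.4 (i) p. 13] -/
theorem sharpBoxDH_subset_smul_of_norm_le (pp : Nat.Primes) (i : Fin (thetaIndex X).lstar)
    (e : (thetaIndex X).Caps (Setting.labelSucc i) → (thetaIndex X).Fibre (.inr pp)) (m : ℤ)
    (hm : haveI : Fact (pp : ℕ).Prime := ⟨pp.2⟩; ‖t pp i (e (Fin.last _))‖ ≤ ‖((pp : ℕ) : ℚ_[pp]) ^ m‖) :
    haveI : Fact (pp : ℕ).Prime := ⟨pp.2⟩
    sharpBoxDH X hlog t pp (Setting.labelSucc i) e ⊆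
      (((pp : ℕ) : ℚ_[pp]) ^ m) • (normalizedPacket pp.1 ((presAtPr X hlog pp).kk e) : Set ((presAtPr X hlog pp).X e)) := by
  haveI : Fact (pp : ℕ).Prime := ⟨pp.2⟩
  haveI : Nonempty ((thetaIndex X).Caps (Setting.labelSucc i)) := ⟨0⟩
  set b : (presAtPr X hlog pp).kk e (Fin.last _) :=
    algebraMap ℚ_[pp] ((presAtPr X hlog pp).kk e (Fin.last _)) (((pp : ℕ) : ℚ_[pp]) ^ m) with hb
  have hp0 : (((pp : ℕ) : ℚ_[pp]) ^ m) ≠ 0 := zpow_ne_zero m (Nat.cast_ne_zero.2 pp.2.ne_zero)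
  have hb0 : b ≠ 0 := by rw [hb]; exact (map_ne_zero _).2 hp0
  have hbn : ‖b‖ = ‖((pp : ℕ) : ℚ_[pp]) ^ m‖ := by rw [hb, norm_algebraMap']
  have h1 : sharpBoxDH X hlog t pp (Setting.labelSucc i) e ⊆
      iota pp.1 ((presAtPr X hlog pp).kk e) (Fin.last _) b •
        (normalizedPacket pp.1 ((presAtPr X hlog pp).kk e) : Set ((presAtPr X hlog pp).X e)) := by
    unfold sharpBoxDH
    rw [labelIdele_labelSucc]
    exact iota_smul_normalizedPacket_subset_of_norm_le_slot pp.1 _ (Fin.last _) hb0 (hbn ▸ hm)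
  refine h1.trans ?_
  rintro _ ⟨y, hy, rfl⟩
  refine ⟨y, hy, ?_⟩
  show (((pp : ℕ) : ℚ_[pp]) ^ m) • y = iota pp.1 ((presAtPr X hlog pp).kk e) (Fin.last _) b • y
  rw [hb, AlgHom.commutes, smul_eq_mul, Algebra.smul_def]

end Sharp

/-! ### §3. `¬ Licence` at a constant bad tuple, deterministic data -/

section Const

variable (tq : ∀ (pp : Nat.Primes) (x : (thetaIndex X).Fibre (.inr pp)), haveI : Fact (pp : ℕ).Prime := ⟨pp.2⟩; kOf X pp.1 x)
  (t : ∀ (pp : Nat.Primes) (_ : Fin X.lstar) (x : (thetaIndex X).Fibre (.inr pp)),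
    haveI : Fact (pp : ℕ).Prime := ⟨pp.2⟩; kOf X pp.1 x)
  (htq0 : ∀ pp x, tq pp x ≠ 0)
  (htq1 : ∀ (pp : Nat.Primes) (x : (thetaIndex X).Fibre (.inr pp)),
    haveI : Fact (pp : ℕ).Prime := ⟨pp.2⟩; placeOf X pp.1 x ∉ X.S → ‖tq pp x‖ = 1)

/-- **`¬ Licence` at `settingPrVolSharp` from ONE place with large `q`-order — deterministic form.** Data: a prime `p`, a
label `j = i+1`, an absorbing scalar `c` (`(R_I)^∼_{v⃗} ⊆ c·I_{v⃗}` at every summand, §1) and a bounding scalar `a`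
(`‖ψ_{v⃗}(y)_i‖ ≤ ‖a‖` on every `c·I_{v⃗}`), Θ-ideles of norm `≤ 1`, and a place `x₀ | p` with `‖t_{Θ,j,x₀}‖ ≤ ‖p^m‖` and
`‖p^m‖·‖a‖ < ‖t_{q,x₀}‖`. Then Step (xi-f)'s licence FAILS: the parent file's criterion at the CONSTANT tuple
`v⃗₀ = (x₀,…,x₀)` with the capsule-symmetric scalar function `p^m·c` on `v⃗₀`, `c` elsewhere, and radii `p^m·a` on `v⃗₀`,
`a` elsewhere. [claim: Mochizuki2012, status: disputed] -/
theorem not_licence_settingPrVolSharp_of_constTuple (pp : Nat.Primes) (i : Fin (thetaIndex X).lstar)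
    (c : haveI : Fact (pp : ℕ).Prime := ⟨pp.2⟩; ℚ_[pp])
    (hc : haveI : Fact (pp : ℕ).Prime := ⟨pp.2⟩
      ∀ (e : (thetaIndex X).Caps (Setting.labelSucc i) → (thetaIndex X).Fibre (.inr pp)) (y : (presAtPr X hlog pp).X e),
        (∀ i', ‖dEquiv pp.1 ((presAtPr X hlog pp).kk e) y i'‖ ≤ 1) → y ∈ c • logShell pp.1 ((presAtPr X hlog pp).kk e))
    (a : haveI : Fact (pp : ℕ).Prime := ⟨pp.2⟩; ℚ_[pp]) (ha0 : a ≠ 0)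
    (ha : haveI : Fact (pp : ℕ).Prime := ⟨pp.2⟩
      ∀ (e : (thetaIndex X).Caps (Setting.labelSucc i) → (thetaIndex X).Fibre (.inr pp)),
        ∀ y ∈ c • logShell pp.1 ((presAtPr X hlog pp).kk e), ∀ i', ‖dEquiv pp.1 ((presAtPr X hlog pp).kk e) y i'‖ ≤ ‖a‖)
    (ht : ∀ pp i x, ‖t pp i x‖ ≤ 1) (x₀ : (thetaIndex X).Fibre (.inr pp)) (m : ℤ)
    (hm : haveI : Fact (pp : ℕ).Prime := ⟨pp.2⟩; ‖t pp i x₀‖ ≤ ‖((pp : ℕ) : ℚ_[pp]) ^ m‖)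
    (hlt : haveI : Fact (pp : ℕ).Prime := ⟨pp.2⟩; ‖((pp : ℕ) : ℚ_[pp]) ^ m‖ * ‖a‖ < ‖tq pp x₀‖) :
    ¬ Thm311ToCor312.Licence
      (settingPrVolSharp X hlog M archPk archSub Ψ act Mmod region n lat sig split qData tq t htq0 htq1) := by
  classical
  haveI : Fact (pp : ℕ).Prime := ⟨pp.2⟩
  haveI : Nonempty ((thetaIndex X).Caps (Setting.labelSucc i)) := ⟨0⟩
  -- the constant tuple and the extra scaling there
  set e₀ : (thetaIndex X).Caps (Setting.labelSucc i) → (thetaIndex X).Fibre (.inr pp) := fun _ => x₀ with he₀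
  set pm : ℚ_[pp] := ((pp : ℕ) : ℚ_[pp]) ^ m with hpm
  have hpm0 : pm ≠ 0 := zpow_ne_zero m (Nat.cast_ne_zero.2 pp.2.ne_zero)
  set d : ((thetaIndex X).Caps (Setting.labelSucc i) → (thetaIndex X).Fibre (.inr pp)) → ℚ_[pp] :=
    fun e => if e = e₀ then pm else 1 with hd
  have hd0 : ∀ e, d e ≠ 0 := fun e => by
    show (if e = e₀ then pm else 1) ≠ 0
    split_ifs
    exacts [hpm0, one_ne_zero]
  -- capsule symmetry of `v⃗ ↦ d(v⃗)` (permutations fix the constant tuple)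
  have hsymm : ∀ (σ : Equiv.Perm ((thetaIndex X).Caps (Setting.labelSucc i))) e, d (e ∘ ⇑σ) = d e := by
    intro σ e
    have key : (e ∘ ⇑σ = e₀) ↔ (e = e₀) := by
      constructor
      · intro h
        funext b
        have := congrFun h (σ.symm b)
        simpa [he₀] using this
      · intro h
        rw [h]
        exact funext fun _ => rfl
    show (if e ∘ ⇑σ = e₀ then pm else 1) = if e = e₀ then pm else 1
    by_cases h : e = e₀
    · rw [if_pos h, if_pos (key.2 h)]
    · rw [if_neg h, if_neg fun h' => h (key.1 h')]
  obtain ⟨i₀⟩ := (inferInstance : Nonempty (DIdx pp.1 ((presAtPr X hlog pp).kk e₀)))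
  refine not_licence_settingPrVolSharp_of_latticeBound X hlog M archPk archSub Ψ act Mmod region n lat sig split qData tq
    t htq0 htq1 pp i (fun e => d e * c) (fun σ e => by show d (e ∘ ⇑σ) * c = d e * c; rw [hsymm σ e]) ?_
    (fun s => (algebraMap ℚ_[pp] (DFac pp.1 ((presAt X hlog pp).kk s.1) s.2) (d s.1 * a) :
      factorFieldDH X hlog (Setting.labelSucc i) (.inr pp) s))
    (fun s => (map_ne_zero (algebraMap ℚ_[pp] (DFac pp.1 ((presAt X hlog pp).kk s.1) s.2))).2
      (mul_ne_zero (hd0 s.1) ha0)) ?_ e₀ i₀ ?_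
  · -- the sharp boxes lie in `d(v⃗)·c·I_{v⃗}`
    intro e y hy
    by_cases he : e = e₀
    · -- constant tuple: box ⊆ p^m·(R_I)^∼ ⊆ p^m·c·I
      have hm' : ‖t pp i (e (Fin.last _))‖ ≤ ‖((pp : ℕ) : ℚ_[pp]) ^ m‖ := by rw [he]; exact hm
      obtain ⟨w, hw, rfl⟩ := sharpBoxDH_subset_smul_of_norm_le X hlog t pp i e m hm' hy
      have hw' : w ∈ c • logShell pp.1 ((presAtPr X hlog pp).kk e) := by
        refine hc e w fun i' => ?_
        have hwi : dEquiv pp.1 ((presAtPr X hlog pp).kk e) w ∈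
            dEquiv pp.1 _ '' (normalizedPacket pp.1 ((presAtPr X hlog pp).kk e) : Set ((presAtPr X hlog pp).X e)) :=
          ⟨w, hw, rfl⟩
        rw [image_normalizedPacket_eq_coe, coe_piUnitBallStructure, mem_polydisc] at hwi
        exact hwi i'
      have hde : d e = pm := by show (if e = e₀ then pm else 1) = pm; rw [if_pos he]
      show pm • w ∈ (d e * c) • logShell pp.1 ((presAtPr X hlog pp).kk e)
      rw [hde, ← smul_smul]
      exact Set.smul_mem_smul_set hw'
    · -- other tuples: box ⊆ (R_I)^∼ ⊆ c·I
      have hde : d e = 1 := by show (if e = e₀ then pm else 1) = 1; rw [if_neg he]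
      show y ∈ (d e * c) • logShell pp.1 ((presAtPr X hlog pp).kk e)
      rw [hde, one_mul]
      refine hc e y fun i' => ?_
      have hyi : dEquiv pp.1 ((presAtPr X hlog pp).kk e) y ∈
          dEquiv pp.1 _ '' (normalizedPacket pp.1 ((presAtPr X hlog pp).kk e) : Set ((presAtPr X hlog pp).X e)) :=
        ⟨y, sharpBoxDH_subset_normalizedPacket X hlog t ht pp _ e hy, rfl⟩
      rw [image_normalizedPacket_eq_coe, coe_piUnitBallStructure, mem_polydisc] at hyi
      exact hyi i'
  · -- the radii `d(v⃗)·a` bound the factor coordinates of `d(v⃗)·c·I_{v⃗}`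
    intro e y hy i'
    show _ ≤ ‖algebraMap ℚ_[pp] (DFac pp.1 ((presAtPr X hlog pp).kk e) i') (d e * a)‖
    rw [norm_algebraMap', norm_mul]
    replace hy : y ∈ (d e * c) • logShell pp.1 ((presAtPr X hlog pp).kk e) := hy
    rw [← smul_smul] at hy
    obtain ⟨w, hw, rfl⟩ := hy
    rw [map_smul, Pi.smul_apply, norm_smul]
    exact mul_le_mul_of_nonneg_left (ha e w hw i') (norm_nonneg _)
  · -- at `(v⃗₀, i₀)` the radius is `‖p^m‖·‖a‖ < ‖t_{q,x₀}‖`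
    have hde : d e₀ = pm := by show (if e₀ = e₀ then pm else 1) = pm; rw [if_pos rfl]
    show ‖algebraMap ℚ_[pp] (DFac pp.1 ((presAtPr X hlog pp).kk e₀) i₀) (d e₀ * a)‖ < ‖tq pp (e₀ (Fin.last _))‖
    rw [norm_algebraMap', norm_mul, hde]
    exact hlt

end Const

/-! ### §4. The threshold form -/

/-- **`¬ Licence` in the LARGE-ORDER REGIME, threshold free of the ideles.** For every prime `p` and label `j = i+1`
there is a constant `C > 0` — depending only on the setting data other than the ideles (the factor-coordinate
radius of the absorbing log-shell lattice of the `(j+1)`-packet at `p`, §1) — such that for ALL Θ-ideles `t` of norm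
`≤ 1`, ALL nonzero `q`-ideles `tq` that are units off `S`, and every place `x₀ | p` and `m ∈ ℤ` with
`‖t_{Θ,j,x₀}‖ ≤ ‖p^m‖` and `‖p^m‖·C < ‖t_{q,x₀}‖`, Step (xi-f)'s `Licence` FAILS for
`settingPrVolSharp … tq t …`. For realising ideles (`‖t_{Θ,j,v}‖ = ‖t_{q,v}‖^{j²}`) this is every datum with
`‖t_{q,x₀}‖^{j²−1}·C·p < 1` at one bad place `x₀`. [claim: Mochizuki2012, status: disputed] -/
theorem exists_threshold_not_licence_settingPrVolSharp (pp : Nat.Primes) (i : Fin (thetaIndex X).lstar) :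
    ∃ C : ℝ, 0 < C ∧
      ∀ (tq : ∀ (pp : Nat.Primes) (x : (thetaIndex X).Fibre (.inr pp)), haveI : Fact (pp : ℕ).Prime := ⟨pp.2⟩; kOf X pp.1 x)
        (t : ∀ (pp : Nat.Primes) (_ : Fin X.lstar) (x : (thetaIndex X).Fibre (.inr pp)),
          haveI : Fact (pp : ℕ).Prime := ⟨pp.2⟩; kOf X pp.1 x)
        (htq0 : ∀ pp x, tq pp x ≠ 0)
        (htq1 : ∀ (pp : Nat.Primes) (x : (thetaIndex X).Fibre (.inr pp)),
          haveI : Fact (pp : ℕ).Prime := ⟨pp.2⟩; placeOf X pp.1 x ∉ X.S → ‖tq pp x‖ = 1),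
        (∀ pp i x, ‖t pp i x‖ ≤ 1) →
        ∀ (x₀ : (thetaIndex X).Fibre (.inr pp)) (m : ℤ),
          (haveI : Fact (pp : ℕ).Prime := ⟨pp.2⟩; ‖t pp i x₀‖ ≤ ‖((pp : ℕ) : ℚ_[pp]) ^ m‖) →
          (haveI : Fact (pp : ℕ).Prime := ⟨pp.2⟩; ‖((pp : ℕ) : ℚ_[pp]) ^ m‖ * C < ‖tq pp x₀‖) →
            ¬ Thm311ToCor312.Licence
              (settingPrVolSharp X hlog M archPk archSub Ψ act Mmod region n lat sig split qData tq t htq0 htq1) := by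
  haveI : Fact (pp : ℕ).Prime := ⟨pp.2⟩
  obtain ⟨c, -, hc⟩ :=
    (presAtPr X hlog pp).exists_const_mem_smul_logShell_of_norm_le_one (Setting.labelSucc i)
  obtain ⟨R, hR0, hR⟩ := (presAtPr X hlog pp).exists_norm_le_of_mem_smul_logShell (Setting.labelSucc i) c
  obtain ⟨a, ha⟩ := NormedField.exists_lt_norm ℚ_[pp] R
  refine ⟨‖a‖, hR0.trans_lt ha, fun tq t htq0 htq1 ht x₀ m hm hlt => ?_⟩
  have ha0 : a ≠ 0 := norm_pos_iff.1 (hR0.trans_lt ha)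
  exact not_licence_settingPrVolSharp_of_constTuple X hlog M archPk archSub Ψ act Mmod region n lat sig split qData tq t
    htq0 htq1 pp i c hc a ha0 (fun e y hy i' => (hR e y hy i').trans ha.le) ht x₀ m hm hlt

end Real

end Thm311

end IUTFork

end Summit.ABC

end
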